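import Summits.Ventures.HodgeRepro2.Sextic

/-!
# Cube coordinates of the inverse, the conjugate and the translates of a CM type (ℤ/6 model)

Blind cell `pub-hodge-repro2`, seat p1 (Tier 4, sub-claim B4, Prop. B4.5(a)–(b)).

In the ℤ/6 model of `Sextic.lean` (embeddings `τ₁∘g^k ↔ k ∈ ℤ/6`, complex conjugation `k ↦ k + 3`,
cube coordinates `s : Fin 3 → Bool` with `s ν = true ⟺ τ_{ν+1} = τ₁∘g^ν ∈ T`, `zType s` the CM type):

* `zInv_zType` — the inverse type `T^{-1} = {−k : k ∈ T}` has coordinates `(b₁, 1 − b₃, 1 − b₂)`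
  (T4-B4 Prop. B4.5(a): «`b_2(T^{-1}) = [τ̄_3 ∈ T]`, `b_3(T^{-1}) = [τ̄_2 ∈ T]`»);
* `zConj_zType` — the conjugate type `T̄ = T + 3` has coordinates `(1 − b₁, 1 − b₂, 1 − b₃)`
  (Prop. B4.5(b));
* `zShift_two_zType` — the translate `T + 2` (change of base embedding by a square `α²`,
  p2's `galEmb_mem_inverseType_galEmb_iff`) has coordinates `(1 − b₂, 1 − b₃, b₁)`
  (Prop. B4.5(a), parenthesis);
* the parity statements: `parity_zInv` (inversion preserves the parity of the coordinate sum),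
  `parity_zConj` (conjugation flips it), `parity_zShift_two` (translation by `2` preserves it) —
  so inversion and base-embedding changes map each parity tetrahedron onto itself and conjugation
  exchanges the two (`zInv_oddTetra`, `zInv_evenTetra` of `Sextic.lean`; `range_inverseType_parityTetrahedron`,
  `range_conjCMType_parityTetrahedron` at field level).

All statements are decided by the kernel over the 8 cube vertices (`decide`).
-/

namespace Summit.Ventures.HodgeRepro2

/-- The coordinate map `(b₁, b₂, b₃) ↦ (b₁, ¬b₃, ¬b₂)` of the inverse type. -/
def cubeInv (s : CubeVertex) : CubeVertex := ![s 0, !s 2, !s 1]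

/-- The coordinate map `(b₁, b₂, b₃) ↦ (¬b₂, ¬b₃, b₁)` of the translate by `2`. -/
def cubeShiftTwo (s : CubeVertex) : CubeVertex := ![!s 1, !s 2, s 0]

/-- Translation of a subset of `ℤ/6` by `g`. -/
def zShift (g : ZMod 6) (Φ : Finset (ZMod 6)) : Finset (ZMod 6) := Φ.image fun k => g + k

/-- The coordinate sum modulo 2 (`true` = odd): the parity class of a cube vertex. -/
def cubeParity (s : CubeVertex) : Bool := (s 0 != s 1) != s 2

/-- **Inversion in coordinates**: `zInv (zType s) = zType (cubeInv s)`, i.e. `T^{-1}` has coordinates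
`(b₁, 1 − b₃, 1 − b₂)` (T4-B4 Prop. B4.5(a)). -/
theorem zInv_zType (s : CubeVertex) : zInv (zType s) = zType (cubeInv s) := by
  revert s; decide

/-- **Conjugation in coordinates**: `T̄ = T + 3 = zType (cubeConj s)`, coordinates `(1−b₁, 1−b₂, 1−b₃)`
(Prop. B4.5(b)). -/
theorem zShift_three_zType (s : CubeVertex) : zShift 3 (zType s) = zType (cubeConj s) := by
  revert s; decide

/-- **Translation by `2` in coordinates**: `T + 2 = zType (cubeShiftTwo s)`, coordinates `(1−b₂, 1−b₃, b₁)`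
(Prop. B4.5(a), the base-embedding change `τ₁ ↦ τ₁∘α`, `α² ∈ ⟨g²⟩`). -/
theorem zShift_two_zType (s : CubeVertex) : zShift 2 (zType s) = zType (cubeShiftTwo s) := by
  revert s; decide

/-- Inversion preserves the parity of the coordinate sum. -/
theorem cubeParity_cubeInv (s : CubeVertex) : cubeParity (cubeInv s) = cubeParity s := by
  revert s; decide

/-- Conjugation flips the parity of the coordinate sum. -/
theorem cubeParity_cubeConj (s : CubeVertex) : cubeParity (cubeConj s) = !cubeParity s := by
  revert s; decide

/-- Translation by `2` preserves the parity of the coordinate sum. -/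
theorem cubeParity_cubeShiftTwo (s : CubeVertex) : cubeParity (cubeShiftTwo s) = cubeParity s := by
  revert s; decide

/-- The odd tetrahedron is exactly the parity class `true`. -/
theorem mem_range_oddTetra_iff (s : CubeVertex) :
    s ∈ Set.range oddTetra ↔ cubeParity s = true := by
  revert s; decide

/-- The even tetrahedron is exactly the parity class `false`. -/
theorem mem_range_evenTetra_iff (s : CubeVertex) :
    s ∈ Set.range evenTetra ↔ cubeParity s = false := by
  revert s; decide

/-- Hence: `cubeInv` and `cubeShiftTwo` map each tetrahedron onto itself, `cubeConj` exchanges them. -/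
theorem cubeInv_mem_range_oddTetra_iff (s : CubeVertex) :
    cubeInv s ∈ Set.range oddTetra ↔ s ∈ Set.range oddTetra := by
  rw [mem_range_oddTetra_iff, mem_range_oddTetra_iff, cubeParity_cubeInv]

/-- Translation by `2` maps the odd tetrahedron onto itself. -/
theorem cubeShiftTwo_mem_range_oddTetra_iff (s : CubeVertex) :
    cubeShiftTwo s ∈ Set.range oddTetra ↔ s ∈ Set.range oddTetra := by
  rw [mem_range_oddTetra_iff, mem_range_oddTetra_iff, cubeParity_cubeShiftTwo]

/-- Conjugation maps the odd tetrahedron onto the even one. -/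
theorem cubeConj_mem_range_evenTetra_iff (s : CubeVertex) :
    cubeConj s ∈ Set.range evenTetra ↔ s ∈ Set.range oddTetra := by
  rw [mem_range_evenTetra_iff, mem_range_oddTetra_iff, cubeParity_cubeConj]
  cases cubeParity s <;> simp

/-- The translate of a parity tetrahedron by any square `2j` (the base-embedding change by `α²`) is
the same tetrahedron: `zShift (2 * j)` preserves the parity class. -/
theorem zShift_two_mul_zType_mem (j : ZMod 6) (s : CubeVertex) :
    ∃ s' : CubeVertex, zShift (2 * j) (zType s) = zType s' ∧ cubeParity s' = cubeParity s := by
  revert j s; decide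

end Summit.Ventures.HodgeRepro2
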